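import Mathlib.Topology.LocalAtTarget
import Literature.Geometry.Lorentzian.KerrConvergence
import Literature.Geometry.Lorentzian.CauchyDevelopment
import Literature.Geometry.Manifold.OpenSubmanifoldMFDeriv
import HarnessLib

/-!
# Oriented `Cᵏ` convergence to Kerr on a horizon-straddling collar

Topic `Geometry/Lorentzian`. Two definitions requested for the route vocabulary of
`Summits/FinalStateConjecture` (crux `CaptureSufficesC2`, item stmt-FinalStateConjecture-14986;
cite item wi-34761), stated in the consequence-form language of `KerrConvergence`
(`ModelBackground`, `Spacetime.deviationCk`, `Spacetime.IsLateChart`) and `CauchyDevelopment`: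

* `Kerr.collarBackground M a r₁` — the **two-sided (horizon-straddling) ingoing Kerr–Schild
  reference background** `(Kerr.region a r₁ = {r > max r₁ 0}, g_{M,a}, t* = x⁰, r)`. For
  `r₁ ∈ (r₋, r₊)` its domain contains the future event horizon `{r = r₊}`
  (`Kerr.futureEventHorizon_subset_collarBackground_domain`), as opposed to the one-sided
  `Kerr.background M a` on `Kerr.exterior M a = {r > r₊}` (recovered at `r₁ = r₊`,
  `Kerr.collarBackground_rPlus`). This is the region on which the printed stability theorems
  conclude: Klainerman–Szeftel, *Kerr stability for small angular momentum*, §3.2.1–§3.2.2 — the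
  near region `𝓜_int` of a GCM admissible spacetime is foliated by `(ū, r)` down to the spacelike
  boundary `𝓐 = {r = (m₀ + √(m₀² − a₀²))(1 − δ_𝓗)} = {r = r₊(1 − δ_𝓗)}`, strictly inside the
  black hole, and by §3.8.4 the future event horizon `𝓗₊` of the limit `𝓜_∞` lies in the interior
  of `𝓜_int` (`r₊,∞(1 − √ε₀ ū^{-1-δ_dec}) ≤ r ≤ r₊,∞(1 + √ε₀ ū^{-1-δ_dec/2})` on `𝓗₊`); Hintz,
  *Nonlinear stability of subextremal Kerr black holes* (2026), (1.2): the conclusion domain is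
  `Ω = {r ≥ m₀, t̃ ≥ 0}` with `m₀ ∈ (r_b⁻, r_b⁺)`.
* `CauchyDevelopment.CollarConvergesToKerr 𝒟 M a r₁ k` — **oriented two-sided `Cᵏ`
  convergence** of a Cauchy development `𝒟 = (𝓜, g, τ, ι, ν)` to `g_{M,a}` on the collar: a late
  time `τ₀` and a collar chart `Ψ : Kerr.region a r₁ → 𝓜`, smooth, an open embedding of the late
  region `{t* > τ₀}`, FUTURE-ORIENTED — `Ψ{t* > τ₀} ⊆ J⁺(ι X)` — with full-slab `Cᵏ` deviation
  `sup_{m ≤ k} sup_{t* = τ} ‖Dᵐ(Ψ^* g − g_{M,a})‖ → 0` as `τ → ∞`. Equivalently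
  (`collarConvergesToKerr_iff`): a late-time chart `Spacetime.IsLateChart` of `KerrConvergence`
  for the region `J⁺(ι X)` on the collar background, plus `deviationCk → 0`. The orientation clause
  is what distinguishes the future development from its time reverse (a late chart into `J⁻(ι X)`
  of the time-reversed development would otherwise qualify); the two-sidedness puts the true event
  horizon inside the chart. Consequence form (as in `KerrConvergence`, module docstring, and
  `StabilityCauchy`) of Klainerman–Szeftel, Main Theorem §3.4.3, (3.4.8) read on
  `𝓜_int ∪ 𝓜_ext` (§3.8.4: in the `(ū, r, x¹, x²)` coordinates of `𝓜_int`,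
  `g = g_{a_∞,m_∞} + O(ε₀ ū^{-1-δ_dec})`, with `𝔡^{≤ k_small}` derivatives), and of Hintz 2026,
  Thm. 1.1 (`|g_{μν} − (g_b)_{μν}| ≲ (1 + t̃)^{-2-ε_K}` on compact sets of `Ω`, with derivatives,
  and decay in all asymptotic regions of `Ω`).

API: `collarBackground_rPlus` (`r₁ = r₊` is the exterior background, `rfl`),
`exterior_le_collarBackground_domain`, `collarBackground_domain_mono`,
`futureEventHorizon_subset_collarBackground_domain`; `collarConvergesToKerr_iff`,
`CollarConvergesToKerr.of_le` (monotone in `k`), `CollarConvergesToKerr.convergesTo_image`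
(the chart is a `Spacetime.ConvergesTo` late embedding for its own image) and
`CollarConvergesToKerr.exists_convergesToKerr` (at `r₁ = r₊` it yields the tree's
`Spacetime.ConvergesToKerr` for some region, the shape used by
`klainerman_szeftel_kerr_stability_small_a_cauchy`); restriction along inclusions of reference
domains (`Spacetime.deviation_comp_inclusion`, `Spacetime.deviationCk_comp_inclusion_le`,
`Spacetime.IsLateChart.comp_inclusion`), whence `CollarConvergesToKerr.anti` (antitone in the
inner radius `r₁`: a collar chart restricts to every smaller collar) and, for `r₁ ≤ r₊`,
`CollarConvergesToKerr.exists_isLateChart_background` /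
`CollarConvergesToKerr.exists_convergesToKerr_of_le` (a collar chart restricts to an oriented
exterior chart on `Kerr.background M a` converging to `g_{M,a}`).

No new facts (`def … : Prop` hypotheses) are introduced: both declarations are definitions with
bodies; nothing is asserted about any development.

## References

* S. Klainerman, J. Szeftel, *Kerr stability for small angular momentum*, Pure Appl. Math. Q. 19
  (2023), 791–1678, arXiv:2104.11857 — §3.2.1 (boundaries of `𝓜`: `𝓐`), §3.2.2 (PG structure on
  `𝓜_int`), §3.4.3 Main Theorem (3.4.8), §3.8.4 (coordinates on `𝓜_int`; location of `𝓗₊`).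
  [KlainermanSzeftel2023]
* P. Hintz, *Nonlinear stability of subextremal Kerr black holes*, arXiv:2606.28253 (2026) —
  (1.2), Thm. 1.1. [Hintz2026]
* M. Dafermos, G. Holzegel, I. Rodnianski, M. Taylor, *The non-linear stability of the
  Schwarzschild family of black holes*, arXiv:2104.08222, §1 (consequence-form conventions of
  `KerrConvergence`). [arXiv210408222]
-/

noncomputable section

open Set Filter Function TopologicalSpace
open scoped Manifold ContDiff ENNReal Topology

universe u

namespace Literature.Geometry.Lorentzian

/-! ### The two-sided collar background -/

namespace Kerr

/-- The **two-sided Kerr–Schild collar background** `(Kerr.region a r₁, g_{M,a}, t* = x⁰, r)`: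
the ingoing Kerr–Schild reference background on the chart domain `{r > max r₁ 0}` with inner
radius `r₁`. For `r₁ ∈ (r₋, r₊)` its domain straddles the future event horizon `{r = r₊}`
(ingoing Kerr–Schild coordinates are regular across it); for `r₁ = r₊` it is the exterior
background `Kerr.background M a`. Klainerman–Szeftel: the near region `𝓜_int` reaches the
spacelike boundary `𝓐 = {r = r₊(1 − δ_𝓗)}`; Hintz 2026, (1.2): `Ω = {r ≥ m₀, t̃ ≥ 0}`,
`r_b⁻ < m₀ < r_b⁺`. [cite: KlainermanSzeftel2023, §3.2.1–§3.2.2 (𝓜_int down to 𝓐 = {r = r₊(1 − δ_𝓗)})] -/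
def collarBackground (M a r₁ : ℝ) : ModelBackground where
  domain := region a r₁
  bilin := bilin M a
  time x := x 0
  radius := radius a

/-- The collar domain is `Kerr.region a r₁ = {r > max r₁ 0}`. [folklore] -/
@[simp]
theorem collarBackground_domain (M a r₁ : ℝ) : (collarBackground M a r₁).domain = region a r₁ :=
  rfl

/-- The collar reference form is the Kerr–Schild form `g_{M,a}`. [folklore] -/
@[simp]
theorem collarBackground_bilin (M a r₁ : ℝ) : (collarBackground M a r₁).bilin = bilin M a := rfl

/-- The collar time function is `t* = x⁰`. [folklore] -/
@[simp]
theorem collarBackground_time (M a r₁ : ℝ) (x : E4) : (collarBackground M a r₁).time x = x 0 :=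
  rfl

/-- The collar radius function is the Kerr–Schild `r`. [folklore] -/
@[simp]
theorem collarBackground_radius (M a r₁ : ℝ) : (collarBackground M a r₁).radius = radius a := rfl

/-- The collar's reference form is the exterior background's form (same Kerr–Schild
components on all of `E4`). [folklore] -/
theorem collarBackground_bilin_eq_background (M a r₁ : ℝ) :
    (collarBackground M a r₁).bilin = (background M a).bilin :=
  rfl

/-- At inner radius `r₁ = r₊` the collar background IS the one-sided exterior background
`Kerr.background M a` (definitionally). [folklore] -/
theorem collarBackground_rPlus (M a : ℝ) : collarBackground M a (rPlus M a) = background M a :=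
  rfl

/-- The collar contains the exterior when `r₁ ≤ r₊` (so a collar chart restricts to an exterior
chart). [folklore] -/
theorem exterior_le_collarBackground_domain {M a r₁ : ℝ} (h : r₁ ≤ rPlus M a) :
    exterior M a ≤ (collarBackground M a r₁).domain :=
  region_mono a h

/-- Collar domains are antitone in the inner radius. [folklore] -/
theorem collarBackground_domain_mono (M a : ℝ) {r₁ r₁' : ℝ} (h : r₁ ≤ r₁') :
    (collarBackground M a r₁').domain ≤ (collarBackground M a r₁).domain :=
  region_mono a h

/-- **Two-sidedness:** for subextremal parameters and an inner radius `r₁ < r₊`, the future event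
horizon `𝓗⁺ = {r = r₊}` lies inside the collar domain (Klainerman–Szeftel, §3.8.4: "`𝓗₊` is
located in the interior of `𝓜_int`"). [cite: KlainermanSzeftel2023, §3.8.4] -/
theorem futureEventHorizon_subset_collarBackground_domain {M a r₁ : ℝ} (hM : IsSubextremal M a)
    (h : r₁ < rPlus M a) :
    futureEventHorizon M a ⊆ ((collarBackground M a r₁).domain : Set E4) := by
  intro x hx
  have hx' : radius a x = rPlus M a := hx
  have h0 : 0 < rPlus M a := hM.rMinus_nonneg.trans_lt hM.rMinus_lt_rPlus
  change max r₁ 0 < radius a x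
  rw [hx']
  exact max_lt h h0

end Kerr

/-! ### Oriented collar convergence of a Cauchy development -/

namespace CauchyDevelopment

variable {X : Type u} [TopologicalSpace X] [ChartedSpace E3 X] [IsManifold (𝓡 3) ∞ X]
  [ConnectedSpace X] {D : InitialDataSet (𝓡 3) X}

/-- **Oriented two-sided `Cᵏ` convergence to Kerr `(M, a)` on the collar `{r > r₁}`** of a
Cauchy development `𝒟 = (𝓜, g, τ, ι, ν)`: there are a late time `τ₀` and a collar chart
`Ψ : Kerr.region a r₁ → 𝓜`, smooth, restricting to an open embedding of the late region
`{t* > τ₀}`, FUTURE-ORIENTED (`Ψ{t* > τ₀} ⊆ J⁺(ι X)`), in which the full two-sided-slab `Cᵏ`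
deviation `sup_{m ≤ k} sup_{t* = τ, r > r₁} ‖Dᵐ(Ψ^* g − g_{M,a})‖` tends to `0` as `τ → ∞`.
Consequence form (conventions of `KerrConvergence`) of Klainerman–Szeftel's Main Theorem read on
`𝓜_int ∪ 𝓜_ext` (`g = g_{a_∞,m_∞} + O(ε₀ ū^{-1-δ_dec})` with `≤ k_small` derivatives, §3.8.4)
and of Hintz 2026, Thm. 1.1 on `Ω = {r ≥ m₀}`. [cite: KlainermanSzeftel2023, Main Theorem §3.4.3 (3.4.8); §3.8.4] -/
def CollarConvergesToKerr (𝒟 : CauchyDevelopment D) (M a r₁ : ℝ) (k : ℕ) : Prop :=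
  ∃ (τ₀ : ℝ) (Ψ : (Kerr.collarBackground M a r₁).domain → 𝒟.carrier),
    ContMDiff 𝓘(ℝ, E4) (𝓡 4) ∞ Ψ ∧
    Topology.IsOpenEmbedding (((Kerr.collarBackground M a r₁).lateRegion τ₀).restrict Ψ) ∧
    Ψ '' (Kerr.collarBackground M a r₁).lateRegion τ₀ ⊆
      𝒟.metric.causalFuture 𝒟.timeOrientation (range 𝒟.embed) ∧
    Tendsto (fun τ ↦ 𝒟.toSpacetime.deviationCk (Kerr.collarBackground M a r₁) Ψ k τ)
      atTop (𝓝 0)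

/-- `CollarConvergesToKerr` is: a late-time chart (`Spacetime.IsLateChart`) on the collar
background for the region `J⁺(ι X)`, with `Cᵏ` deviation `→ 0`. [folklore] -/
theorem collarConvergesToKerr_iff {𝒟 : CauchyDevelopment D} {M a r₁ : ℝ} {k : ℕ} :
    𝒟.CollarConvergesToKerr M a r₁ k ↔
      ∃ (τ₀ : ℝ) (Ψ : (Kerr.collarBackground M a r₁).domain → 𝒟.carrier),
        𝒟.toSpacetime.IsLateChart (Kerr.collarBackground M a r₁)
          (𝒟.metric.causalFuture 𝒟.timeOrientation (range 𝒟.embed)) τ₀ Ψ ∧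
        Tendsto (fun τ ↦ 𝒟.toSpacetime.deviationCk (Kerr.collarBackground M a r₁) Ψ k τ)
          atTop (𝓝 0) := by
  constructor
  · rintro ⟨τ₀, Ψ, h₁, h₂, h₃, h₄⟩
    exact ⟨τ₀, Ψ, ⟨h₁, h₂, h₃⟩, h₄⟩
  · rintro ⟨τ₀, Ψ, ⟨h₁, h₂, h₃⟩, h₄⟩
    exact ⟨τ₀, Ψ, h₁, h₂, h₃, h₄⟩

/-- Constructor from a late-time chart with decaying deviation. [folklore] -/
theorem CollarConvergesToKerr.of_isLateChart {𝒟 : CauchyDevelopment D} {M a r₁ : ℝ} {k : ℕ}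
    {τ₀ : ℝ} {Ψ : (Kerr.collarBackground M a r₁).domain → 𝒟.carrier}
    (hΨ : 𝒟.toSpacetime.IsLateChart (Kerr.collarBackground M a r₁)
      (𝒟.metric.causalFuture 𝒟.timeOrientation (range 𝒟.embed)) τ₀ Ψ)
    (ht : Tendsto (fun τ ↦ 𝒟.toSpacetime.deviationCk (Kerr.collarBackground M a r₁) Ψ k τ)
      atTop (𝓝 0)) :
    𝒟.CollarConvergesToKerr M a r₁ k :=
  collarConvergesToKerr_iff.2 ⟨τ₀, Ψ, hΨ, ht⟩

/-- Collar convergence in `Cᵏ'` implies collar convergence in `Cᵏ` for `k ≤ k'` (same chart).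
[folklore] -/
theorem CollarConvergesToKerr.of_le {𝒟 : CauchyDevelopment D} {M a r₁ : ℝ} {k k' : ℕ}
    (h : 𝒟.CollarConvergesToKerr M a r₁ k') (hk : k ≤ k') : 𝒟.CollarConvergesToKerr M a r₁ k := by
  obtain ⟨τ₀, Ψ, h₁, h₂, h₃, h₄⟩ := h
  refine ⟨τ₀, Ψ, h₁, h₂, h₃, ?_⟩
  exact tendsto_of_tendsto_of_tendsto_of_le_of_le tendsto_const_nhds h₄ (fun _ ↦ zero_le)
    fun τ ↦ 𝒟.toSpacetime.deviationCk_mono (Kerr.collarBackground M a r₁) Ψ hk τ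

/-- A collar chart is a late-time EMBEDDING (`Spacetime.IsLateEmbedding`: the covering clause is
vacuous) for its own image, so collar convergence gives `Spacetime.ConvergesTo` on the collar
background for the region `Ψ{t* > τ₀}`. [folklore] -/
theorem CollarConvergesToKerr.convergesTo_image {𝒟 : CauchyDevelopment D} {M a r₁ : ℝ} {k : ℕ}
    (h : 𝒟.CollarConvergesToKerr M a r₁ k) :
    ∃ (τ₀ : ℝ) (Ψ : (Kerr.collarBackground M a r₁).domain → 𝒟.carrier),
      Ψ '' (Kerr.collarBackground M a r₁).lateRegion τ₀ ⊆
        𝒟.metric.causalFuture 𝒟.timeOrientation (range 𝒟.embed) ∧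
      𝒟.toSpacetime.IsLateEmbedding (Kerr.collarBackground M a r₁)
        (Ψ '' (Kerr.collarBackground M a r₁).lateRegion τ₀) τ₀ Ψ ∧
      Tendsto (fun τ ↦ 𝒟.toSpacetime.deviationCk (Kerr.collarBackground M a r₁) Ψ k τ)
        atTop (𝓝 0) := by
  obtain ⟨τ₀, Ψ, h₁, h₂, h₃, h₄⟩ := h
  refine ⟨τ₀, Ψ, h₃, ⟨⟨h₁, h₂, subset_rfl⟩, ?_⟩, h₄⟩
  exact fun x hx ↦ absurd hx.1 hx.2

/-- Collar convergence yields `Spacetime.ConvergesTo` (the tree's consequence-form convergence,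
with its covering clause) for SOME region of the development inside `J⁺(ι X)`, on the same
background. [folklore] -/
theorem CollarConvergesToKerr.exists_convergesTo {𝒟 : CauchyDevelopment D} {M a r₁ : ℝ} {k : ℕ}
    (h : 𝒟.CollarConvergesToKerr M a r₁ k) :
    ∃ 𝒟oc : Set 𝒟.carrier,
      𝒟oc ⊆ 𝒟.metric.causalFuture 𝒟.timeOrientation (range 𝒟.embed) ∧
      𝒟.toSpacetime.ConvergesTo (Kerr.collarBackground M a r₁) 𝒟oc k := by
  obtain ⟨τ₀, Ψ, hJ, hE, ht⟩ := h.convergesTo_image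
  exact ⟨_, hJ, τ₀, Ψ, hE, ht⟩

/-- At inner radius `r₁ = r₊` collar convergence is oriented one-sided convergence: it yields the
tree's `Spacetime.ConvergesToKerr … M a k` for some region inside `J⁺(ι X)` — the shape of the
conclusion of `klainerman_szeftel_kerr_stability_small_a_cauchy` (`StabilityCauchy`).
[folklore] -/
theorem CollarConvergesToKerr.exists_convergesToKerr {𝒟 : CauchyDevelopment D} {M a : ℝ} {k : ℕ}
    (h : 𝒟.CollarConvergesToKerr M a (Kerr.rPlus M a) k) :
    ∃ 𝒟oc : Set 𝒟.carrier,
      𝒟oc ⊆ 𝒟.metric.causalFuture 𝒟.timeOrientation (range 𝒟.embed) ∧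
      𝒟.toSpacetime.ConvergesToKerr 𝒟oc M a k :=
  h.exists_convergesTo

end CauchyDevelopment

/-! ### Restricting a chart along an inclusion of reference domains

A collar chart on `{r > r₁}` restricts to a collar chart on every smaller collar `{r > r₁'}`,
`r₁ ≤ r₁'`, with the same late time, orientation and decay — in particular (`r₁' = r₊`) to an
oriented late-time chart on the one-sided exterior background `Kerr.background M a`. The
bookkeeping is generic: for two reference backgrounds `B'`, `B` with `B'.domain ≤ B.domain`
whose reference forms (and time / radius functions) agree on the smaller domain, composing a
chart `Ψ : B.domain → 𝓢` with the inclusion `ι : B'.domain → B.domain` does not change the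
metric deviation at points of `B'.domain` (the inclusion of open subsets of `E4` has identity
differential, Lee 2013, Prop. 3.9), hence does not increase the slab `Cᵏ` norms, and preserves
the late-chart property. -/

section OpensInclusion

/-- The inclusion `U → V` of open subsets `U ≤ V` of `E4` has identity differential (both
inclusions into `E4` do, `OpenSubmanifold.mfderiv_subtype_val`, and `val_V ∘ ι = val_U`;
Lee 2013, Prop. 3.9). [folklore] -/
private theorem mfderiv_opensInclusion {U V : Opens E4} (h : U ≤ V) (x : U) :
    mfderiv 𝓘(ℝ, E4) 𝓘(ℝ, E4) (Opens.inclusion h) x = ContinuousLinearMap.id ℝ E4 := by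
  have hι : MDifferentiableAt 𝓘(ℝ, E4) 𝓘(ℝ, E4) (Opens.inclusion h) x :=
    (contMDiff_inclusion (n := ∞) h x).mdifferentiableAt (by simp)
  have hc := mfderiv_comp x
    (_root_.Literature.Geometry.Manifold.OpenSubmanifold.hasMFDerivAt_subtype_val
      (I := 𝓘(ℝ, E4)) (Opens.inclusion h x)).mdifferentiableAt hι
  have hval : (Subtype.val : V → E4) ∘ Opens.inclusion h = (Subtype.val : U → E4) := rfl
  rw [hval, _root_.Literature.Geometry.Manifold.OpenSubmanifold.mfderiv_subtype_val,
    _root_.Literature.Geometry.Manifold.OpenSubmanifold.mfderiv_subtype_val] at hc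
  rw [← ContinuousLinearMap.id_comp (mfderiv 𝓘(ℝ, E4) 𝓘(ℝ, E4) (Opens.inclusion h) x)]
  exact hc.symm

/-- Chain rule along the inclusion of open subsets of `E4`: `d(Ψ ∘ ι)(x) = dΨ(ι x)`.
[folklore] -/
private theorem mfderiv_comp_opensInclusion {U V : Opens E4} (h : U ≤ V) {N : Type*}
    [TopologicalSpace N] [ChartedSpace E4 N] {Ψ : V → N} {x : U}
    (hΨ : MDifferentiableAt 𝓘(ℝ, E4) (𝓡 4) Ψ (Opens.inclusion h x)) :
    mfderiv 𝓘(ℝ, E4) (𝓡 4) (Ψ ∘ Opens.inclusion h) x =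
      mfderiv 𝓘(ℝ, E4) (𝓡 4) Ψ (Opens.inclusion h x) := by
  rw [mfderiv_comp x hΨ ((contMDiff_inclusion (n := ∞) h x).mdifferentiableAt (by simp)),
    mfderiv_opensInclusion]
  exact ContinuousLinearMap.comp_id _

end OpensInclusion

namespace Spacetime

variable (𝓢 : Spacetime.{u} 4)

/-- **Restricting a chart does not change the metric deviation.** For backgrounds `B'`, `B`
with `B'.domain ≤ B.domain` and the same reference form on `B'.domain`, and a smooth chart
`Ψ : B.domain → 𝓢`, the deviation of `Ψ ∘ ι` from `B'` at `x` is the deviation of `Ψ` from `B`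
at `ι x` (the inclusion `ι` of open subsets of `E4` has identity differential; Lee 2013,
Prop. 3.9; DHRT arXiv:2104.08222, §1 for the deviation). [folklore] -/
theorem deviation_comp_inclusion {B B' : ModelBackground} (h : B'.domain ≤ B.domain)
    (hb : ∀ x : B'.domain, B'.bilin x.1 = B.bilin x.1) {Ψ : B.domain → 𝓢.carrier}
    (hΨ : ContMDiff 𝓘(ℝ, E4) (𝓡 4) ∞ Ψ) (x : B'.domain) :
    𝓢.deviation B' (Ψ ∘ Opens.inclusion h) x = 𝓢.deviation B Ψ (Opens.inclusion h x) := by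
  have hd := mfderiv_comp_opensInclusion h (x := x) ((hΨ _).mdifferentiableAt (by simp))
  refine ContinuousLinearMap.ext fun v ↦ ContinuousLinearMap.ext fun w ↦ ?_
  rw [deviation_apply, deviation_apply, hb]
  exact congrArg (fun L : E4 →L[ℝ] TangentSpace (𝓡 4) (Ψ (Opens.inclusion h x)) ↦
    𝓢.metric.val (Ψ (Opens.inclusion h x)) (L v) (L w) - B.bilin x.1 v w) hd

/-- Extended-by-zero form of `deviation_comp_inclusion`: on the smaller domain the two extended
deviations agree. [folklore] -/
theorem deviationExtend_comp_inclusion_of_mem {B B' : ModelBackground} (h : B'.domain ≤ B.domain)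
    (hb : ∀ x : B'.domain, B'.bilin x.1 = B.bilin x.1) {Ψ : B.domain → 𝓢.carrier}
    (hΨ : ContMDiff 𝓘(ℝ, E4) (𝓡 4) ∞ Ψ) {z : E4} (hz : z ∈ B'.domain) :
    𝓢.deviationExtend B' (Ψ ∘ Opens.inclusion h) z = 𝓢.deviationExtend B Ψ z := by
  have e1 := 𝓢.deviationExtend_coe B' (Ψ ∘ Opens.inclusion h) ⟨z, hz⟩
  have e2 := 𝓢.deviationExtend_coe B Ψ ⟨z, h hz⟩
  exact e1.trans ((𝓢.deviation_comp_inclusion h hb hΨ ⟨z, hz⟩).trans e2.symm)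

/-- On subsets of the smaller domain, the `Cᵏ` sup norms of the two extended deviations agree
(the extended deviations agree on the open set `B'.domain`, hence so do all their derivatives
there). [folklore] -/
theorem supCkENorm_deviationExtend_comp_inclusion {B B' : ModelBackground}
    (h : B'.domain ≤ B.domain) (hb : ∀ x : B'.domain, B'.bilin x.1 = B.bilin x.1)
    {Ψ : B.domain → 𝓢.carrier} (hΨ : ContMDiff 𝓘(ℝ, E4) (𝓡 4) ∞ Ψ) {S : Set E4}
    (hS : S ⊆ B'.domain) (k : ℕ) :
    supCkENorm S k (𝓢.deviationExtend B' (Ψ ∘ Opens.inclusion h)) =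
      supCkENorm S k (𝓢.deviationExtend B Ψ) := by
  have hev : ∀ z ∈ S,
      𝓢.deviationExtend B' (Ψ ∘ Opens.inclusion h) =ᶠ[𝓝 z] 𝓢.deviationExtend B Ψ := by
    intro z hz
    filter_upwards [B'.domain.isOpen.mem_nhds (hS hz)] with y hy
    exact 𝓢.deviationExtend_comp_inclusion_of_mem h hb hΨ hy
  simp only [supCkENorm]
  refine iSup_congr fun m ↦ iSup_congr fun _ ↦ iSup_congr fun z ↦ iSup_congr fun hz ↦ ?_
  rw [((hev z hz).iteratedFDeriv ℝ m).eq_of_nhds]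

/-- **Restriction does not increase the slab `Cᵏ` deviation**: with the same time function on
the smaller domain, the slabs `{t = τ}` of `B'` are parts of those of `B`, on which the extended
deviations agree. [folklore] -/
theorem deviationCk_comp_inclusion_le {B B' : ModelBackground} (h : B'.domain ≤ B.domain)
    (hb : ∀ x : B'.domain, B'.bilin x.1 = B.bilin x.1)
    (ht : ∀ x : B'.domain, B'.time x.1 = B.time x.1) {Ψ : B.domain → 𝓢.carrier}
    (hΨ : ContMDiff 𝓘(ℝ, E4) (𝓡 4) ∞ Ψ) (k : ℕ) (τ : ℝ) :
    𝓢.deviationCk B' (Ψ ∘ Opens.inclusion h) k τ ≤ 𝓢.deviationCk B Ψ k τ := by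
  have hS : Subtype.val '' B'.timeSlab τ ⊆ (B'.domain : Set E4) := by
    rintro _ ⟨x, -, rfl⟩
    exact x.2
  have hsub : Subtype.val '' B'.timeSlab τ ⊆ Subtype.val '' B.timeSlab τ := by
    rintro _ ⟨x, hx, rfl⟩
    exact ⟨Opens.inclusion h x, ((ht x).symm.trans hx : B.time x.1 = τ), rfl⟩
  rw [deviationCk, deviationCk, 𝓢.supCkENorm_deviationExtend_comp_inclusion h hb hΨ hS]
  exact supCkENorm_mono hsub _ _

/-- Restriction does not increase the truncated-slab `Cᵏ` deviation (same time and radius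
functions on the smaller domain). [folklore] -/
theorem truncDeviationCk_comp_inclusion_le {B B' : ModelBackground} (h : B'.domain ≤ B.domain)
    (hb : ∀ x : B'.domain, B'.bilin x.1 = B.bilin x.1)
    (ht : ∀ x : B'.domain, B'.time x.1 = B.time x.1)
    (hr : ∀ x : B'.domain, B'.radius x.1 = B.radius x.1) {Ψ : B.domain → 𝓢.carrier}
    (hΨ : ContMDiff 𝓘(ℝ, E4) (𝓡 4) ∞ Ψ) (k : ℕ) (R τ : ℝ) :
    𝓢.truncDeviationCk B' (Ψ ∘ Opens.inclusion h) k R τ ≤ 𝓢.truncDeviationCk B Ψ k R τ := by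
  have hS : Subtype.val '' B'.truncTimeSlab R τ ⊆ (B'.domain : Set E4) := by
    rintro _ ⟨x, -, rfl⟩
    exact x.2
  have hsub : Subtype.val '' B'.truncTimeSlab R τ ⊆ Subtype.val '' B.truncTimeSlab R τ := by
    rintro _ ⟨x, hx, rfl⟩
    exact ⟨Opens.inclusion h x,
      ⟨((ht x).symm.trans hx.1 : B.time x.1 = τ), ((hr x).symm.trans_le hx.2 : B.radius x.1 ≤ R)⟩,
      rfl⟩
  rw [truncDeviationCk, truncDeviationCk,
    𝓢.supCkENorm_deviationExtend_comp_inclusion h hb hΨ hS]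
  exact supCkENorm_mono hsub _ _

variable {𝓢}

/-- **A late-time chart restricts to a late-time chart** along an inclusion of reference
domains with the same time function: smoothness, the open-embedding property of the late
region `{t > τ₀}` (an open embedding restricted to a preimage is an open embedding) and the
image condition pass to `Ψ ∘ ι` (DHRT arXiv:2104.08222, §1). [folklore] -/
theorem IsLateChart.comp_inclusion {B B' : ModelBackground} {𝒟 : Set 𝓢.carrier} {τ₀ : ℝ}
    {Ψ : B.domain → 𝓢.carrier} (hΨ : 𝓢.IsLateChart B 𝒟 τ₀ Ψ) (h : B'.domain ≤ B.domain)
    (ht : ∀ x : B'.domain, B'.time x.1 = B.time x.1) :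
    𝓢.IsLateChart B' 𝒟 τ₀ (Ψ ∘ Opens.inclusion h) where
  contMDiff := hΨ.contMDiff.comp (contMDiff_inclusion h)
  isOpenEmbedding := by
    have hL : B'.lateRegion τ₀ = Opens.inclusion h ⁻¹' B.lateRegion τ₀ := by
      ext x
      show τ₀ < B'.time x.1 ↔ τ₀ < B.time x.1
      rw [ht x]
    rw [hL]
    exact hΨ.isOpenEmbedding.comp ((Opens.isOpenEmbedding_of_le h).restrictPreimage _)
  image_subset := by
    rintro _ ⟨x, hx, rfl⟩
    exact hΨ.image_subset ⟨Opens.inclusion h x, (hx.trans_eq (ht x) : τ₀ < B.time x.1), rfl⟩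

end Spacetime

namespace CauchyDevelopment

variable {X : Type u} [TopologicalSpace X] [ChartedSpace E3 X] [IsManifold (𝓡 3) ∞ X]
  [ConnectedSpace X] {D : InitialDataSet (𝓡 3) X}

/-- **Collar convergence is antitone in the inner radius**: a collar chart on `{r > r₁}`
restricts, along the inclusion `Kerr.region a r₁' ≤ Kerr.region a r₁` (`r₁ ≤ r₁'`), to a collar
chart on `{r > r₁'}` with the same late time and orientation, and its slab `Cᵏ` deviation does
not increase (`Spacetime.deviationCk_comp_inclusion_le`). [folklore] -/
theorem CollarConvergesToKerr.anti {𝒟 : CauchyDevelopment D} {M a r₁ r₁' : ℝ} {k : ℕ}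
    (h : 𝒟.CollarConvergesToKerr M a r₁ k) (hr : r₁ ≤ r₁') :
    𝒟.CollarConvergesToKerr M a r₁' k := by
  rw [collarConvergesToKerr_iff] at h ⊢
  obtain ⟨τ₀, Ψ, hΨ, hlim⟩ := h
  have hdom : (Kerr.collarBackground M a r₁').domain ≤ (Kerr.collarBackground M a r₁).domain :=
    Kerr.collarBackground_domain_mono M a hr
  refine ⟨τ₀, Ψ ∘ Opens.inclusion hdom, hΨ.comp_inclusion hdom fun _ ↦ rfl, ?_⟩
  exact tendsto_of_tendsto_of_tendsto_of_le_of_le tendsto_const_nhds hlim (fun _ ↦ zero_le)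
    fun τ ↦ 𝒟.toSpacetime.deviationCk_comp_inclusion_le hdom (fun _ ↦ rfl) (fun _ ↦ rfl)
      hΨ.contMDiff k τ

/-- **A collar chart restricts to an oriented exterior chart**: for `r₁ ≤ r₊`, collar
convergence yields a late-time chart on the one-sided exterior background `Kerr.background M a`
(domain `Kerr.exterior M a`, late region `Kerr.lateRegion M a τ₀`) into `J⁺(ι X)` whose slab
`Cᵏ` deviation from `g_{M,a}` tends to `0`. [folklore] -/
theorem CollarConvergesToKerr.exists_isLateChart_background {𝒟 : CauchyDevelopment D}
    {M a r₁ : ℝ} {k : ℕ} (h : 𝒟.CollarConvergesToKerr M a r₁ k) (hr : r₁ ≤ Kerr.rPlus M a) :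
    ∃ (τ₀ : ℝ) (Φ : (Kerr.background M a).domain → 𝒟.carrier),
      𝒟.toSpacetime.IsLateChart (Kerr.background M a)
          (𝒟.metric.causalFuture 𝒟.timeOrientation (range 𝒟.embed)) τ₀ Φ ∧
        Tendsto (fun τ ↦ 𝒟.toSpacetime.deviationCk (Kerr.background M a) Φ k τ)
          atTop (𝓝 0) :=
  collarConvergesToKerr_iff.1 (h.anti hr)

/-- For `r₁ ≤ r₊`, collar convergence yields the tree's one-sided consequence-form convergence
`Spacetime.ConvergesToKerr … M a k` for some region of the development inside `J⁺(ι X)` (the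
shape of the conclusion of `klainerman_szeftel_kerr_stability_small_a_cauchy`,
`StabilityCauchy`). [folklore] -/
theorem CollarConvergesToKerr.exists_convergesToKerr_of_le {𝒟 : CauchyDevelopment D}
    {M a r₁ : ℝ} {k : ℕ} (h : 𝒟.CollarConvergesToKerr M a r₁ k) (hr : r₁ ≤ Kerr.rPlus M a) :
    ∃ 𝒟oc : Set 𝒟.carrier,
      𝒟oc ⊆ 𝒟.metric.causalFuture 𝒟.timeOrientation (range 𝒟.embed) ∧
      𝒟.toSpacetime.ConvergesToKerr 𝒟oc M a k :=
  (h.anti hr).exists_convergesToKerr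

end CauchyDevelopment

end Literature.Geometry.Lorentzian

end
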